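import Summits.BirchSwinnertonDyer.BirchSwinnertonDyer.Theorems.ResidualThetaTransportAtTwoThetaLayerLambdaCongruenceAtTwoHeckeAdjointJordanSeq
import HarnessLib

/-!
# Crux `ThetaLayerLambdaCongruenceAtTwo` (stmt-BirchSwinnertonDyer-20688, route ResidualThetaTransportAtTwo), line
# `birth` v14 — SD floor, kernel road, Hecke clause of IP, brick HA5b «DISCRETE JORDAN LEMMA, finiteness»: the flags `(a b; c e)` for
# which the Jordan correction `Σ_{j<m} Φ(j,j+1) − Φ(0,m)` of a convex Farey chain is non-zero lie in an explicit BOX (width seat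
# bsd-wall-rtt-p3-w3 g11; `--supports stmt-BirchSwinnertonDyer-20688 --as helper`; closes nothing)

HONEST FRAMING. Elementary THEOREMS about finite integer sequences (continuation of `…HeckeAdjointJordanSeq`); no definition; nothing about any
curve or form is asserted; BSD is not proved by any of this.

WHAT (memo `Cruxes/ThetaLayerLambdaCongruenceAtTwo/Lines/birth-sd2-hecke-adjoint.md`, step (E)). With the notation of `…JordanSeq`
(`s_j = x_j c − y_j a`, `t_j = x_j e − y_j b`, `ae − bc = 1`, `Φ(i,k)` the lexicographic flag indicator): if the correction
`κ = Σ_{j<m} Φ(j,j+1) − Φ(0,m)` is non-zero then the flag sits at a vertex `P_i` (`jordan_generic`) and, by the incident-edge evaluations,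
(i) at an interior vertex `|t_{i−1}| ≤ D(i−1,i+1)` (`jordan_window_mid`: `ε(š_{i−1}+š_{i+1}) = 2D(i−1,i+1) > 0` by Plücker); (ii) at the last
vertex `|t_{m−1}| ≤ y_{m−1}` (`jordan_window_last`); (iii) at `P₀ = ∞`, `|b| ≤ |x_1| + |x_m| + 1` (`jordan_window_zero`). Hence ALL exceptional
flags satisfy `|a|, |b|, |c|, |e| ≤ 3M³`, `M = 1 + Σ_{j≤m}(|x_j| + |y_j|)` (`jordan_box`): finitely many — the finiteness that makes the
κ-cancellation `Σ'_{u∈Γ₀} κ(u⁻¹γ) = Σ'_{u∈Γ₀} κ(u⁻¹)` legitimate (brick HA6).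

References: [Merel1995Homologie] §1.2; [Manin1972] §1.5.
-/

set_option autoImplicit false

noncomputable section

-- justification: the `Summit.BirchSwinnertonDyer.BirchSwinnertonDyer.…` path repeats a component (route-file convention)
set_option linter.dupNamespace false

open scoped Classical

namespace Summit.BirchSwinnertonDyer.BirchSwinnertonDyer.Theorems.ThetaLayerLambdaCongruenceAtTwo

section Windows

/-- **Interior vertex window.** At a vertex flag `(a,c) = εP_i`, `0 < i < m`, `t_i = ε`: if the Jordan correction is non-zero then
`|t_{i−1}| ≤ D(i−1,i+1) = x_{i−1}y_{i+1} − x_{i+1}y_{i−1}`. [cite: Merel1995Homologie, §1.2] -/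
theorem jordan_window_mid (m : ℕ) (x y : ℕ → ℤ) (hy0 : y 0 = 0) (hypos : ∀ j, 1 ≤ j → j ≤ m → 0 < y j)
    (hdet : ∀ j, j < m → x j * y (j + 1) - x (j + 1) * y j = 1) (a b c e : ℤ) (hdet1 : a * e - b * c = 1) (s t : ℕ → ℤ)
    (hs : ∀ j, s j = x j * c - y j * a) (ht : ∀ j, t j = x j * e - y j * b) (Φ : ℕ → ℕ → ℤ)
    (hΦ : ∀ i k, Φ i k = if (0 < (-(s k)) * s i ∨ ((-(s k)) * s i = 0 ∧ (0 < (-(s k) + 2 * -(t k)) * (s i + 2 * t i) ∨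
        ((-(s k) + 2 * -(t k)) * (s i + 2 * t i) = 0 ∧ 0 < (-(s k)) * t i + (-(t k)) * s i)))) then (1 : ℤ) else 0)
    (i : ℕ) (hi0 : 0 < i) (hi : i < m) (ε : ℤ) (hε : ε = 1 ∨ ε = -1) (ha : a = ε * x i) (hc : c = ε * y i) (hti : t i = ε)
    (hκ : (∑ j ∈ Finset.range m, Φ j (j + 1)) ≠ Φ 0 m) :
    |t (i - 1)| ≤ x (i - 1) * y (i + 1) - x (i + 1) * y (i - 1) := by
  have hε2 : ε * ε = 1 := by rcases hε with rfl | rfl <;> norm_num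
  -- the sum has only the two incident terms
  have hsum : (∑ j ∈ Finset.range m, Φ j (j + 1)) = Φ (i - 1) (i - 1 + 1) + Φ i (i + 1) := by
    apply Finset.sum_eq_add_of_mem (i - 1) i (Finset.mem_range.mpr (by omega)) (Finset.mem_range.mpr hi) (by omega)
    intro j hj hne
    rw [Finset.mem_range] at hj
    exact jordan_vertex_nonincident m x y hy0 hypos hdet a c s t hs Φ hΦ i hi.le ε hε ha hc j hj hne.2 (by omega)
  rw [show i - 1 + 1 = i by omega] at hsum
  rw [hsum, jordan_vertex_in m x y hdet a c s t hs Φ hΦ i hi0 hi.le ε hε ha hc hti,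
    jordan_vertex_out m x y hdet a c s t hs Φ hΦ i hi ε hε ha hc hti,
    jordan_vertex_long_mid m x y hy0 hypos hdet a c s t hs Φ hΦ i hi0 hi ε hε ha hc] at hκ
  -- `s_{i-1} = ε`, `s_{i+1} = -ε`, Plücker: `ε (t_{i-1} + t_{i+1}) = D(i-1,i+1)`
  have hsm : s (i - 1) = ε := by
    rw [jordan_vertex_s x y a c s hs i ε ha hc (i - 1)]
    have h := hdet (i - 1) (by omega); rw [show i - 1 + 1 = i by omega] at h; rw [h, mul_one]
  have hsp : s (i + 1) = -ε := by
    rw [jordan_vertex_s x y a c s hs i ε ha hc (i + 1)]; linear_combination ε * (-(hdet i hi))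
  have hpl := jordan_pluecker x y a b c e s t hs ht (i - 1) (i + 1)
  rw [hdet1, mul_one, hsm, hsp] at hpl
  have hδ : 0 < x (i - 1) * y (i + 1) - x (i + 1) * y (i - 1) := negCF_cross_pos m x y hy0 hypos hdet (i - 1) (i + 1) (by omega) (by omega)
  -- case analysis on the two indicators
  by_cases h1 : ε * (s (i - 1) + 2 * t (i - 1)) < 0
  · by_cases h2 : ε * (s (i + 1) + 2 * t (i + 1)) < 0
    · exfalso; rw [hsm] at h1; rw [hsp] at h2; rcases hε with rfl | rfl <;> linarith
    · rw [if_pos h1, if_neg h2] at hκ; simp at hκ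
  · by_cases h2 : ε * (s (i + 1) + 2 * t (i + 1)) < 0
    · rw [if_neg h1, if_pos h2] at hκ; simp at hκ
    · rw [hsm] at h1; rw [hsp] at h2
      push Not at h1 h2
      rw [abs_le]
      rcases hε with rfl | rfl <;> constructor <;> nlinarith

/-- **Terminal vertex window.** At the vertex flag `(a,c) = εP_m` (`m ≥ 1`, `t_m = ε`): if the Jordan correction is non-zero then
`|t_{m−1}| ≤ y_{m−1}`. [cite: Merel1995Homologie, §1.2] -/
theorem jordan_window_last (m : ℕ) (x y : ℕ → ℤ) (hx0 : x 0 = 1) (hy0 : y 0 = 0) (hm : 1 ≤ m) (hypos : ∀ j, 1 ≤ j → j ≤ m → 0 < y j)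
    (hdet : ∀ j, j < m → x j * y (j + 1) - x (j + 1) * y j = 1) (a b c e : ℤ) (hdet1 : a * e - b * c = 1) (s t : ℕ → ℤ)
    (hs : ∀ j, s j = x j * c - y j * a) (ht : ∀ j, t j = x j * e - y j * b) (Φ : ℕ → ℕ → ℤ)
    (hΦ : ∀ i k, Φ i k = if (0 < (-(s k)) * s i ∨ ((-(s k)) * s i = 0 ∧ (0 < (-(s k) + 2 * -(t k)) * (s i + 2 * t i) ∨
        ((-(s k) + 2 * -(t k)) * (s i + 2 * t i) = 0 ∧ 0 < (-(s k)) * t i + (-(t k)) * s i)))) then (1 : ℤ) else 0)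
    (ε : ℤ) (hε : ε = 1 ∨ ε = -1) (ha : a = ε * x m) (hc : c = ε * y m) (htm : t m = ε)
    (hκ : (∑ j ∈ Finset.range m, Φ j (j + 1)) ≠ Φ 0 m) :
    |t (m - 1)| ≤ y (m - 1) := by
  have hε2 : ε * ε = 1 := by rcases hε with rfl | rfl <;> norm_num
  have hsum : (∑ j ∈ Finset.range m, Φ j (j + 1)) = Φ (m - 1) (m - 1 + 1) := by
    apply Finset.sum_eq_single (m - 1)
    · intro j hj hne
      rw [Finset.mem_range] at hj
      exact jordan_vertex_nonincident m x y hy0 hypos hdet a c s t hs Φ hΦ m le_rfl ε hε ha hc j hj (by omega) (by omega)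
    · intro h; exact absurd (Finset.mem_range.mpr (by omega)) h
  rw [show m - 1 + 1 = m by omega] at hsum
  rw [hsum, jordan_vertex_in m x y hdet a c s t hs Φ hΦ m hm le_rfl ε hε ha hc htm,
    jordan_vertex_long_last m x y hx0 hy0 hm hypos a c s t hs Φ hΦ ε hε ha hc htm] at hκ
  have hsmm : s (m - 1) = ε := by
    rw [jordan_vertex_s x y a c s hs m ε ha hc (m - 1)]
    have h := hdet (m - 1) (by omega); rw [show m - 1 + 1 = m by omega] at h; rw [h, mul_one]
  have hs0 : s 0 = ε * y m := by rw [jordan_vertex_s x y a c s hs m ε ha hc 0, hx0, hy0]; ring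
  -- Plücker (0, m-1): `s_0 t_{m-1} - s_{m-1} t_0 = y_{m-1}`
  have hpl := jordan_pluecker x y a b c e s t hs ht 0 (m - 1)
  rw [hdet1, mul_one, hsmm, hs0, hx0, hy0, one_mul, mul_zero, sub_zero] at hpl
  have hym : 0 < y m := hypos m hm le_rfl
  have hym1 : 0 ≤ y (m - 1) := by
    rcases Nat.lt_or_ge 1 m with h | h
    · exact (hypos (m - 1) (by omega) (by omega)).le
    · rw [show m - 1 = 0 by omega, hy0]
  by_cases h1 : ε * (s (m - 1) + 2 * t (m - 1)) < 0
  · -- then also `ε š_0 < 0`: both indicators are 1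
    have h2 : ε * (s 0 + 2 * t 0) < 0 := by
      rw [hsmm] at h1; rw [hs0]
      -- `ε t_0 = y_m (ε t_{m-1}) - y_{m-1}` from Plücker
      have e0 : ε * t 0 = y m * (ε * t (m - 1)) - y (m - 1) := by
        have := hpl
        rcases hε with rfl | rfl <;> linarith
      nlinarith
    rw [if_pos h1, if_pos h2] at hκ; exact absurd rfl hκ
  · by_cases h2 : ε * (s 0 + 2 * t 0) < 0
    · rw [hsmm] at h1; rw [hs0] at h2
      push Not at h1
      have e0 : ε * t 0 = y m * (ε * t (m - 1)) - y (m - 1) := by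
        have := hpl
        rcases hε with rfl | rfl <;> linarith
      rw [abs_le]
      rcases hε with rfl | rfl <;> constructor <;> nlinarith
    · rw [if_neg h1, if_neg h2] at hκ; exact absurd rfl hκ

/-- **Initial vertex window.** At the vertex flag `(a,c) = εP₀ = (ε, 0)` (`m ≥ 1`, `t_0 = e = ε`): if the Jordan correction is non-zero
then `|b| ≤ |x_1| + |x_m| + 1` (the foot `εb + ½` lies between `x_m/y_m` and `x_1`). [cite: Merel1995Homologie, §1.2] -/
theorem jordan_window_zero (m : ℕ) (x y : ℕ → ℤ) (hx0 : x 0 = 1) (hy0 : y 0 = 0) (hm : 1 ≤ m) (hypos : ∀ j, 1 ≤ j → j ≤ m → 0 < y j)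
    (hdet : ∀ j, j < m → x j * y (j + 1) - x (j + 1) * y j = 1) (a b c e : ℤ) (s t : ℕ → ℤ)
    (hs : ∀ j, s j = x j * c - y j * a) (ht : ∀ j, t j = x j * e - y j * b) (Φ : ℕ → ℕ → ℤ)
    (hΦ : ∀ i k, Φ i k = if (0 < (-(s k)) * s i ∨ ((-(s k)) * s i = 0 ∧ (0 < (-(s k) + 2 * -(t k)) * (s i + 2 * t i) ∨
        ((-(s k) + 2 * -(t k)) * (s i + 2 * t i) = 0 ∧ 0 < (-(s k)) * t i + (-(t k)) * s i)))) then (1 : ℤ) else 0)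
    (ε : ℤ) (hε : ε = 1 ∨ ε = -1) (ha : a = ε * x 0) (hc : c = ε * y 0) (ht0 : t 0 = ε)
    (hκ : (∑ j ∈ Finset.range m, Φ j (j + 1)) ≠ Φ 0 m) :
    |b| ≤ |x 1| + |x m| + 1 := by
  have hε2 : ε * ε = 1 := by rcases hε with rfl | rfl <;> norm_num
  have hsum : (∑ j ∈ Finset.range m, Φ j (j + 1)) = Φ 0 (0 + 1) := by
    apply Finset.sum_eq_single 0
    · intro j hj hne
      rw [Finset.mem_range] at hj
      exact jordan_vertex_nonincident m x y hy0 hypos hdet a c s t hs Φ hΦ 0 (Nat.zero_le _) ε hε ha hc j hj hne (by omega)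
    · intro h; exact absurd (Finset.mem_range.mpr (by omega)) h
  rw [hsum, jordan_vertex_out m x y hdet a c s t hs Φ hΦ 0 (by omega) ε hε ha hc ht0,
    jordan_vertex_long_zero m x y hx0 hy0 hm hypos a c s t hs Φ hΦ ε hε ha hc ht0] at hκ
  simp only [zero_add] at hκ
  -- `e = ε`, `s_j = -ε y_j`, `t_j = ε x_j - y_j b`
  have he : e = ε := by rw [ht, hx0, hy0] at ht0; linarith
  have hy1 : y 1 = 1 := by have h := hdet 0 (by omega); rw [hx0, hy0] at h; linarith
  have hs1 : s 1 = -ε := by rw [jordan_vertex_s x y a c s hs 0 ε ha hc 1, hx0, hy0, hy1]; ring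
  have hsm : s m = -(ε * y m) := by rw [jordan_vertex_s x y a c s hs 0 ε ha hc m, hx0, hy0]; ring
  have ht1 : t 1 = ε * x 1 - b := by rw [ht, he, hy1]; ring
  have htm : t m = ε * x m - y m * b := by rw [ht, he]; ring
  have hym : 0 < y m := hypos m hm le_rfl
  have hD : 0 ≤ x 1 * y m - x m := by
    rcases Nat.lt_or_ge 1 m with h | h
    · have := negCF_cross_pos m x y hy0 hypos hdet 1 m h le_rfl; rw [hy1] at this; linarith
    · have : m = 1 := by omega
      subst this; rw [hy1]; linarith
  rw [hs1, ht1] at hκ; rw [hsm, htm] at hκ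
  -- `εš_1 = 2x_1 - 1 - 2εb`, `εš_m = 2x_m - y_m(1 + 2εb)`
  by_cases h1 : ε * (-ε + 2 * (ε * x 1 - b)) < 0
  · have h2 : ε * (-(ε * y m) + 2 * (ε * x m - y m * b)) ≤ 0 := by
      rcases hε with rfl | rfl <;> nlinarith
    rw [if_pos h1, if_pos h2] at hκ; exact absurd rfl hκ
  · by_cases h2 : ε * (-(ε * y m) + 2 * (ε * x m - y m * b)) ≤ 0
    · push Not at h1
      have hym1 : 0 ≤ y m - 1 := by linarith
      rw [abs_le]
      rcases hε with rfl | rfl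
      · constructor
        · by_contra hcon
          push Not at hcon
          have hb2 : 1 + 2 * b ≤ 0 := by linarith [abs_nonneg (x 1), abs_nonneg (x m)]
          have hprod : (y m - 1) * (1 + 2 * b) ≤ 0 := mul_nonpos_of_nonneg_of_nonpos hym1 hb2
          nlinarith [neg_abs_le (x m), abs_nonneg (x 1)]
        · nlinarith [le_abs_self (x 1), abs_nonneg (x m)]
      · constructor
        · nlinarith [le_abs_self (x 1), abs_nonneg (x m)]
        · by_contra hcon
          push Not at hcon
          have hb2 : 0 ≤ 2 * b - 1 := by linarith [abs_nonneg (x 1), abs_nonneg (x m)]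
          have hprod : 0 ≤ (y m - 1) * (2 * b - 1) := mul_nonneg hym1 hb2
          nlinarith [neg_abs_le (x m), abs_nonneg (x 1)]
    · rw [if_neg h1, if_neg h2] at hκ; exact absurd rfl hκ

end Windows

/-! ## The box -/

section Box

/-- **The exceptional flags lie in a box (brick HA5b).** For a convex Farey chain and `M = 1 + Σ_{j≤m}(|x_j| + |y_j|)`: every
`(a b; c e) ∈ SL₂(ℤ)` whose Jordan correction `Σ_{j<m} Φ(j,j+1) − Φ(0,m)` is non-zero has all entries bounded by `3M³` in absolute value.
(Generic vanishing ⇒ a vertex `P_i`; `(a,c) = εP_i`, `t_i = ε`; the windows bound `t_{i−1}` (or `b` at `i = 0`); `(b, e)` is recovered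
from `(t_{i−1}, t_i)` by Cramer with determinant `D(i−1,i) = 1`.) [cite: Merel1995Homologie, §1.2] -/
theorem jordan_box (m : ℕ) (x y : ℕ → ℤ) (hx0 : x 0 = 1) (hy0 : y 0 = 0) (hm : 1 ≤ m) (hypos : ∀ j, 1 ≤ j → j ≤ m → 0 < y j)
    (hdet : ∀ j, j < m → x j * y (j + 1) - x (j + 1) * y j = 1) (a b c e : ℤ) (hdet1 : a * e - b * c = 1) (s t : ℕ → ℤ)
    (hs : ∀ j, s j = x j * c - y j * a) (ht : ∀ j, t j = x j * e - y j * b) (Φ : ℕ → ℕ → ℤ)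
    (hΦ : ∀ i k, Φ i k = if (0 < (-(s k)) * s i ∨ ((-(s k)) * s i = 0 ∧ (0 < (-(s k) + 2 * -(t k)) * (s i + 2 * t i) ∨
        ((-(s k) + 2 * -(t k)) * (s i + 2 * t i) = 0 ∧ 0 < (-(s k)) * t i + (-(t k)) * s i)))) then (1 : ℤ) else 0)
    (hκ : (∑ j ∈ Finset.range m, Φ j (j + 1)) ≠ Φ 0 m) :
    |a| ≤ 3 * (1 + ∑ j ∈ Finset.range (m + 1), (|x j| + |y j|)) ^ 3 ∧
      |b| ≤ 3 * (1 + ∑ j ∈ Finset.range (m + 1), (|x j| + |y j|)) ^ 3 ∧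
      |c| ≤ 3 * (1 + ∑ j ∈ Finset.range (m + 1), (|x j| + |y j|)) ^ 3 ∧
      |e| ≤ 3 * (1 + ∑ j ∈ Finset.range (m + 1), (|x j| + |y j|)) ^ 3 := by
  set M : ℤ := 1 + ∑ j ∈ Finset.range (m + 1), (|x j| + |y j|) with hM
  have hMj : ∀ j, j ≤ m → |x j| + |y j| ≤ M - 1 := by
    intro j hj
    have h := Finset.single_le_sum (f := fun j ↦ |x j| + |y j|) (fun i _ ↦ by positivity) (Finset.mem_range.mpr (Nat.lt_succ_of_le hj))
    linarith
  have hM1 : 1 ≤ M := by have := hMj 0 (Nat.zero_le _); linarith [abs_nonneg (x 0), abs_nonneg (y 0)]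
  have hM2 : M ≤ M * M := by nlinarith
  have hM3 : M ≤ M ^ 3 := by
    calc M ≤ M * M := hM2
      _ ≤ M * M * M := by nlinarith
      _ = M ^ 3 := by ring
  have hMM : M * (2 * M ^ 2) + M ≤ 3 * M ^ 3 := by
    have : M * (2 * M ^ 2) = 2 * M ^ 3 := by ring
    linarith
  -- a vertex
  have hvert : ∃ i, i ≤ m ∧ s i = 0 := by
    by_contra h
    push Not at h
    exact hκ (jordan_generic m x y hx0 hy0 hypos hdet a c s t hs Φ hΦ fun j hj ↦ h j hj)
  obtain ⟨i, hi, hsi⟩ := hvert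
  obtain ⟨ε, hε, ha, hc, hti⟩ := jordan_vertex_shape m x y hm hdet a b c e hdet1 s t hs ht i hi hsi
  have hεabs : |ε| = 1 := by rcases hε with rfl | rfl <;> norm_num
  have hxi := hMj i hi
  have habs_a : |a| ≤ M := by rw [ha, abs_mul, hεabs, one_mul]; linarith [abs_nonneg (y i)]
  have habs_c : |c| ≤ M := by rw [hc, abs_mul, hεabs, one_mul]; linarith [abs_nonneg (x i)]
  refine ⟨by linarith, ?_, by linarith, ?_⟩
  all_goals rcases Nat.eq_zero_or_pos i with rfl | hi0
  -- `b` at `i = 0`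
  · have hb := jordan_window_zero m x y hx0 hy0 hm hypos hdet a b c e s t hs ht Φ hΦ ε hε ha hc hti hκ
    have h1 := hMj 1 hm; have h2 := hMj m le_rfl
    nlinarith [abs_nonneg (y 1), abs_nonneg (y m)]
  -- `b` at `i ≥ 1`: `b = x_i t_{i-1} - x_{i-1} t_i`
  · have hW : |t (i - 1)| ≤ 2 * M ^ 2 := by
      rcases Nat.lt_or_ge i m with him | him
      · have h := jordan_window_mid m x y hy0 hypos hdet a b c e hdet1 s t hs ht Φ hΦ i hi0 him ε hε ha hc hti hκ
        have h1 := hMj (i - 1) (by omega); have h2 := hMj (i + 1) (by omega)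
        have e1 : x (i - 1) * y (i + 1) - x (i + 1) * y (i - 1) ≤ |x (i - 1)| * |y (i + 1)| + |x (i + 1)| * |y (i - 1)| := by
          rw [← abs_mul, ← abs_mul]
          linarith [le_abs_self (x (i - 1) * y (i + 1)), neg_abs_le (x (i + 1) * y (i - 1))]
        nlinarith [abs_nonneg (x (i - 1)), abs_nonneg (y (i + 1)), abs_nonneg (x (i + 1)), abs_nonneg (y (i - 1))]
      · have : i = m := le_antisymm hi him
        subst this
        have h := jordan_window_last i x y hx0 hy0 hm hypos hdet a b c e hdet1 s t hs ht Φ hΦ ε hε ha hc hti hκ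
        have h1 := hMj (i - 1) (by omega)
        nlinarith [abs_nonneg (x (i - 1)), le_abs_self (y (i - 1))]
    have hb : b = x i * t (i - 1) - x (i - 1) * t i := by
      rw [ht, ht]
      have h := hdet (i - 1) (by omega); rw [show i - 1 + 1 = i by omega] at h
      linear_combination (-b) * h
    have h1 := hMj (i - 1) (by omega)
    rw [hb, hti]
    calc |x i * t (i - 1) - x (i - 1) * ε| ≤ |x i * t (i - 1)| + |x (i - 1) * ε| := abs_sub _ _
      _ = |x i| * |t (i - 1)| + |x (i - 1)| := by rw [abs_mul, abs_mul, hεabs, mul_one]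
      _ ≤ M * (2 * M ^ 2) + M := by gcongr <;> linarith [abs_nonneg (y i), abs_nonneg (y (i - 1))]
      _ ≤ 3 * M ^ 3 := hMM
  -- `e` at `i = 0`: `e = t_0 = ε`
  · have he : e = ε := by rw [ht, hx0, hy0] at hti; linarith
    rw [he, hεabs]; linarith
  -- `e` at `i ≥ 1`: `e = y_i t_{i-1} - y_{i-1} t_i`
  · have hW : |t (i - 1)| ≤ 2 * M ^ 2 := by
      rcases Nat.lt_or_ge i m with him | him
      · have h := jordan_window_mid m x y hy0 hypos hdet a b c e hdet1 s t hs ht Φ hΦ i hi0 him ε hε ha hc hti hκ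
        have h1 := hMj (i - 1) (by omega); have h2 := hMj (i + 1) (by omega)
        have e1 : x (i - 1) * y (i + 1) - x (i + 1) * y (i - 1) ≤ |x (i - 1)| * |y (i + 1)| + |x (i + 1)| * |y (i - 1)| := by
          rw [← abs_mul, ← abs_mul]
          linarith [le_abs_self (x (i - 1) * y (i + 1)), neg_abs_le (x (i + 1) * y (i - 1))]
        nlinarith [abs_nonneg (x (i - 1)), abs_nonneg (y (i + 1)), abs_nonneg (x (i + 1)), abs_nonneg (y (i - 1))]
      · have : i = m := le_antisymm hi him
        subst this
        have h := jordan_window_last i x y hx0 hy0 hm hypos hdet a b c e hdet1 s t hs ht Φ hΦ ε hε ha hc hti hκ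
        have h1 := hMj (i - 1) (by omega)
        nlinarith [abs_nonneg (x (i - 1)), le_abs_self (y (i - 1))]
    have he : e = y i * t (i - 1) - y (i - 1) * t i := by
      rw [ht, ht]
      have h := hdet (i - 1) (by omega); rw [show i - 1 + 1 = i by omega] at h
      linear_combination (-e) * h
    have h1 := hMj (i - 1) (by omega)
    rw [he, hti]
    calc |y i * t (i - 1) - y (i - 1) * ε| ≤ |y i * t (i - 1)| + |y (i - 1) * ε| := abs_sub _ _
      _ = |y i| * |t (i - 1)| + |y (i - 1)| := by rw [abs_mul, abs_mul, hεabs, mul_one]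
      _ ≤ M * (2 * M ^ 2) + M := by gcongr <;> linarith [abs_nonneg (x i), abs_nonneg (x (i - 1))]
      _ ≤ 3 * M ^ 3 := hMM

end Box

end Summit.BirchSwinnertonDyer.BirchSwinnertonDyer.Theorems.ThetaLayerLambdaCongruenceAtTwo

end
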